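import Summits.CriticalPhenomena.SAWScalingLimit.Theorems.SAWDevelopingMapObservableToSLETypeLadderCarvedReductionSqueezeFamilyAscent
import Summits.CriticalPhenomena.SAWScalingLimit.Theorems.SAWDevelopingMapObservableToSLECanonicalTransferExhaustion
import HarnessLib

/-!
# The TWO-PIECE admissible family (piece (G2-fam) of stub T2b″ `stub_carvedReduction_squeezeSolid`)

Crux `SAWDevelopingMap.ObservableToSLE` (stmt-CriticalPhenomena-10472), line `six-class-type-ladder`,
stub T2b″.  Landing target:
`Summits/CriticalPhenomena/SAWScalingLimit/Theorems/SAWDevelopingMapObservableToSLETypeLadderCarvedReductionSqueezeFamily.lean`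
(`--supports stmt-CriticalPhenomena-10472`).  Sequel of `…SqueezeFamilyAscent`.

**The two-piece port of the inner admissible discretisation (M1)** (`twoPiece_exists_innerFamily`).
Let `Ω` be a bounded open connected set with connected exterior `(cl Ω)ᶜ` of frontier `∂Ω` (any
Jordan domain), with two GATES `p 0`, `p 1` at possibly DIFFERENT heights: above the floor
`Im = Im(p i)` the disc `B(p i, ρF)` lies in `Ω`, the closed box `[Re(p i) ± ρc] × [Im(p i) - ρc', Im(p i)]`
misses `Ω` (the design of the outer Jordan approximants of the carved domains at a gate: flat
segment, vertical legs), the gates are `2(ρc + ρc') + ρF` apart; let `m i δ` be FREE threshold rows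
above the floors (`Im(δ c_u) ≤ Im(p i) → row u < m i δ`) converging to them
(`row u < m i δ → Im(δ c_u) < Im(p i) + ε` eventually, every `ε > 0`).  Then there are finite vertex
sets `L δ` — the main component of the deep set of `…SqueezeFamilyCore` — which, for all small `δ`,
are SIMPLY CONNECTED and CONNECTED lattice domains inside `Ω`, eventually contain the lattice points
of every compact `K ⊆ Ω`, have EXACT ROWS `≥ m i δ` in `B(p i, ρF/32)`, and are CLOSED UNDER
CLEARLY-DEEP PATHS (the clause putting the whole pinned carved lattice region inside the family).
Registered: `stub_carvedReduction_twoPieceCompactReach` (the deep reachability of compacts,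
`twoPiece_pathIn_of_isCompact`).
-/

noncomputable section

open scoped Topology
open Filter Set Metric
open Literature.Probability.LatticeModels (HexVertex hexGraph hexCenter Site)
open Literature.Probability.RandomPlanarGeometry
open Literature.Probability.RandomPlanarGeometry.SAW
open Literature.Probability.Percolation (PathIn hexCenter_im hexCenter_re)

namespace Summit.CriticalPhenomena.SAWScalingLimit.Theorems.ObservableToSLE.TypeLadder

open Summit.CriticalPhenomena.SAWScalingLimit.Theorems.ObservableToSLE.FloorRatio

/-! ### Compacts are reached through deep vertices -/

/-- **Compacts are reached through deep vertices.**  For a compact `K ⊆ Ω` and a base point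
`x₀ ∈ Ω` there is `ε > 0` such that at every mesh `δ ≤ ε/50` at which the thresholds are within `ε/8`
of the floors, every vertex of `K` is joined to any vertex within `δ` of `x₀` through vertices that
are DEEP (disc of radius `ε/2` inside `Ω`, hence in no excluded zone by clamping into the gate box). -/
theorem twoPiece_pathIn_of_isCompact {Ω : Set ℂ} {p : Fin 2 → ℂ} {ρc ρc' : ℝ} (hΩo : IsOpen Ω)
    (hΩc : IsConnected Ω) (hρc : 0 ≤ ρc) (hρc' : 0 ≤ ρc')
    (hB : ∀ i (z : ℂ), |z.re - (p i).re| ≤ ρc → (p i).im - ρc' ≤ z.im → z.im ≤ (p i).im → z ∉ Ω)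
    {K : Set ℂ} (hK : IsCompact K) (hKΩ : K ⊆ Ω) {x₀ : ℂ} (hx₀ : x₀ ∈ Ω) :
    ∃ ε > (0 : ℝ), ∀ (δ : ℝ) (m mlo : Fin 2 → ℤ) (X : Set ℂ), 0 < δ → δ ≤ ε / 50 →
      (∀ i (u : HexVertex), u.1 1 < m i → ((δ : ℂ) * hexCenter u).im < (p i).im + ε / 8) →
      (∀ i (u : HexVertex), mlo i ≤ u.1 1 → (p i).im - ρc' ≤ ((δ : ℂ) * hexCenter u).im) →
      ∀ v₀ v : HexVertex, dist ((δ : ℂ) * hexCenter v₀) x₀ ≤ δ → (δ : ℂ) * hexCenter v ∈ K →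
        PathIn hexGraph {u : HexVertex | (δ : ℂ) * hexCenter u ∈ Ω ∧
          (∀ i, ¬ (|((δ : ℂ) * hexCenter u).re - (p i).re| < ρc + 10 * δ ∧ mlo i ≤ u.1 1 ∧ u.1 1 < m i)) ∧
          closedBall ((δ : ℂ) * hexCenter u) (25 * δ) ⊆ Ω ∪ X} v₀ v := by
  obtain ⟨ε, hε, hwalk⟩ := exists_walk_deep_of_isCompact hΩo hΩc hK hKΩ hx₀
  refine ⟨ε, hε, fun δ m mlo X hδ hδε hthr hzone v₀ v hv₀ hv => ?_⟩
  obtain ⟨q, hq⟩ := hwalk δ (ε / 2) hδ (by linarith) v₀ v hv₀ hv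
  refine pathIn_of_walk q fun u hu => ⟨hq u hu (mem_closedBall_self (by linarith)), fun i hz => ?_,
    (closedBall_subset_closedBall (by linarith)).trans ((hq u hu).trans fun x hx => Or.inl hx)⟩
  obtain ⟨h1, h2, h3⟩ := hz
  exact twoPiece_not_zone_of_closedBall_subset (hB i) (hq u hu) hρc hρc' hδ.le (by positivity) h1
    (hzone i u h2) (hthr i u h3) (by linarith)

/-- **Registered sub-goal `stub_carvedReduction_twoPieceCompactReach`** (crux item
stmt-CriticalPhenomena-10472, stub T2b″ `stub_carvedReduction_squeezeSolid`, piece (G2-fam) COMPACTS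
ARE REACHED THROUGH DEEP VERTICES): registry form of `twoPiece_pathIn_of_isCompact`. -/
theorem stub_carvedReduction_twoPieceCompactReach :
    ∀ (Ω : Set ℂ) (p : Fin 2 → ℂ) (ρc ρc' : ℝ) (K : Set ℂ) (x₀ : ℂ), IsOpen Ω → IsConnected Ω → 0 ≤ ρc → 0 ≤ ρc' →
      (∀ i (z : ℂ), |z.re - (p i).re| ≤ ρc → (p i).im - ρc' ≤ z.im → z.im ≤ (p i).im → z ∉ Ω) →
      IsCompact K → K ⊆ Ω → x₀ ∈ Ω →
      ∃ ε > (0 : ℝ), ∀ (δ : ℝ) (m mlo : Fin 2 → ℤ) (X : Set ℂ), 0 < δ → δ ≤ ε / 50 →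
        (∀ i (u : HexVertex), u.1 1 < m i → ((δ : ℂ) * hexCenter u).im < (p i).im + ε / 8) →
        (∀ i (u : HexVertex), mlo i ≤ u.1 1 → (p i).im - ρc' ≤ ((δ : ℂ) * hexCenter u).im) →
        ∀ v₀ v : HexVertex, dist ((δ : ℂ) * hexCenter v₀) x₀ ≤ δ → (δ : ℂ) * hexCenter v ∈ K →
          PathIn hexGraph {u : HexVertex | (δ : ℂ) * hexCenter u ∈ Ω ∧
            (∀ i, ¬ (|((δ : ℂ) * hexCenter u).re - (p i).re| < ρc + 10 * δ ∧ mlo i ≤ u.1 1 ∧ u.1 1 < m i)) ∧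
            closedBall ((δ : ℂ) * hexCenter u) (25 * δ) ⊆ Ω ∪ X} v₀ v :=
  fun _ _ _ _ _ _ hΩo hΩc hρc hρc' hB hK hKΩ hx₀ => twoPiece_pathIn_of_isCompact hΩo hΩc hρc hρc' hB hK hKΩ hx₀

/-! ### The family -/

/-- **THE TWO-PIECE ADMISSIBLE FAMILY** (two-piece port of `FloorRatio.exists_innerFamily`); see the
module docstring. -/
theorem twoPiece_exists_innerFamily {Ω : Set ℂ} {p : Fin 2 → ℂ} {ρc ρc' ρF : ℝ}
    (hΩo : IsOpen Ω) (hΩc : IsConnected Ω) (hΩb : Bornology.IsBounded Ω)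
    (hE : IsConnected (closure Ω)ᶜ) (hEfr : frontier (closure Ω)ᶜ = frontier Ω)
    (hρc : 0 < ρc) (hρc' : 0 < ρc') (hρF : 0 < ρF) (hFc : ρF ≤ ρc) (hFc' : ρF ≤ ρc')
    (hsep : ∀ i j, i ≠ j → 2 * (ρc + ρc') + ρF ≤ dist (p i) (p j))
    (hB : ∀ i (z : ℂ), |z.re - (p i).re| ≤ ρc → (p i).im - ρc' ≤ z.im → z.im ≤ (p i).im → z ∉ Ω)
    (hfl : ∀ i, {z : ℂ | (p i).im < z.im} ∩ ball (p i) ρF ⊆ Ω)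
    {m : Fin 2 → ℝ → ℤ}
    (hm_lo : ∀ i (δ : ℝ) (u : HexVertex), 0 < δ → ((δ : ℂ) * hexCenter u).im ≤ (p i).im → u.1 1 < m i δ)
    (hm_hi : ∀ i, ∀ ε > (0 : ℝ), ∀ᶠ δ : ℝ in 𝓝[>] 0, ∀ u : HexVertex, u.1 1 < m i δ →
      ((δ : ℂ) * hexCenter u).im < (p i).im + ε) :
    ∃ L : ℝ → Finset HexVertex,
      (∀ᶠ δ : ℝ in 𝓝[>] 0, hexDomainSimplyConnected (L δ) ∧
        (hexGraph.induce (↑(L δ) : Set HexVertex)).Preconnected ∧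
        ∀ v ∈ L δ, (δ : ℂ) * hexCenter v ∈ Ω) ∧
      (∀ K : Set ℂ, IsCompact K → K ⊆ Ω →
        ∀ᶠ δ : ℝ in 𝓝[>] 0, ∀ v : HexVertex, (δ : ℂ) * hexCenter v ∈ K → v ∈ L δ) ∧
      (∀ᶠ δ : ℝ in 𝓝[>] 0, ∀ (i : Fin 2) (v : HexVertex), dist ((δ : ℂ) * hexCenter v) (p i) < ρF / 32 →
        (v ∈ L δ ↔ m i δ ≤ v.1 1)) ∧
      (∀ᶠ δ : ℝ in 𝓝[>] 0, ∀ z w : HexVertex, z ∈ L δ →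
        PathIn hexGraph {u : HexVertex | (δ : ℂ) * hexCenter u ∈ Ω ∧
          closedBall ((δ : ℂ) * hexCenter u) (25 * δ) ⊆ Ω ∪
            ⋃ i, {x : ℂ | |x.re - (p i).re| ≤ ρc ∧ (p i).im - 30 * δ ≤ x.im ∧ x.im ≤ (p i).im} ∧
          ∀ i, |((δ : ℂ) * hexCenter u).re - (p i).re| < ρc + 10 * δ →
            |((δ : ℂ) * hexCenter u).im - (p i).im| < ρc' → m i δ ≤ u.1 1} z w → w ∈ L δ) := by
  classical
  -- a bound for `Ω`
  obtain ⟨R, hR0, hΩR⟩ := hΩb.subset_ball_lt 0 0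
  have hR : ∀ z ∈ Ω, ‖z‖ < R := fun z hz => mem_ball_zero_iff.1 (hΩR hz)
  -- the internal data at mesh `δ`
  set mlo : Fin 2 → ℝ → ℤ := fun i δ =>
    ⌈((p i).im - ρc' + 8 * δ) / (δ * (Real.sqrt 3 / 2)) - 1 / 3⌉ with hmlo
  set X : ℝ → Set ℂ := fun δ =>
    ⋃ i, {x : ℂ | |x.re - (p i).re| ≤ ρc ∧ (p i).im - 30 * δ ≤ x.im ∧ x.im ≤ (p i).im} with hX
  set S : ℝ → Set HexVertex := fun δ => {u : HexVertex | (δ : ℂ) * hexCenter u ∈ Ω ∧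
    (∀ i, ¬ (|((δ : ℂ) * hexCenter u).re - (p i).re| < ρc + 10 * δ ∧ mlo i δ ≤ u.1 1 ∧ u.1 1 < m i δ)) ∧
    closedBall ((δ : ℂ) * hexCenter u) (25 * δ) ⊆ Ω ∪ X δ} with hS
  -- the base point and base vertex
  set x₀ : ℂ := p 0 + ((ρF / 4 : ℝ) : ℂ) * Complex.I with hx₀
  have hball : ∀ i, closedBall (p i + ((ρF / 4 : ℝ) : ℂ) * Complex.I) (ρF / 16) ⊆ Ω := by
    intro i z hz
    rw [mem_closedBall, dist_eq_norm] at hz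
    refine hfl i ⟨?_, ?_⟩
    · show (p i).im < z.im
      have h1 : (p i + ((ρF / 4 : ℝ) : ℂ) * Complex.I).im - z.im ≤ ‖z - (p i + ((ρF / 4 : ℝ) : ℂ) * Complex.I)‖ := by
        rw [← norm_neg, neg_sub, ← Complex.sub_im]; exact Complex.im_le_norm _
      have h2 : (p i + ((ρF / 4 : ℝ) : ℂ) * Complex.I).im = (p i).im + ρF / 4 := by simp
      linarith
    · rw [mem_ball, dist_eq_norm]
      calc ‖z - p i‖ = ‖(z - (p i + ((ρF / 4 : ℝ) : ℂ) * Complex.I)) + ((ρF / 4 : ℝ) : ℂ) * Complex.I‖ := by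
            congr 1; ring
        _ ≤ ‖z - (p i + ((ρF / 4 : ℝ) : ℂ) * Complex.I)‖ + ‖((ρF / 4 : ℝ) : ℂ) * Complex.I‖ := norm_add_le _ _
        _ ≤ ρF / 16 + ρF / 4 := by
            refine add_le_add hz ?_
            rw [norm_mul, Complex.norm_real, Complex.norm_I, mul_one, Real.norm_of_nonneg (by positivity)]
        _ < ρF := by linarith
  have hx₀Ω : x₀ ∈ Ω := hball 0 (mem_closedBall_self (by positivity))
  have hv₀ex : ∀ δ : ℝ, 0 < δ → ∃ v : HexVertex, dist ((δ : ℂ) * hexCenter v) x₀ ≤ δ :=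
    fun δ hδ => exists_vertex_dist_le hδ x₀
  set v₀ : ℝ → HexVertex := fun δ => if hδ : 0 < δ then (hv₀ex δ hδ).choose else ((0 : Site 2), 0)
    with hv₀
  have hv₀d : ∀ δ : ℝ, 0 < δ → dist ((δ : ℂ) * hexCenter (v₀ δ)) x₀ ≤ δ := by
    intro δ hδ
    have e : v₀ δ = (hv₀ex δ hδ).choose := by simp only [hv₀, dif_pos hδ]
    rw [e]; exact (hv₀ex δ hδ).choose_spec
  -- the hypotheses of the inner-domain lemma at a good mesh
  set δ₁ : ℝ := min (ρc / 40) (ρc' / 80) with hδ₁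
  have hδ₁0 : 0 < δ₁ := lt_min (by positivity) (by positivity)
  have hgood : ∀ δ : ℝ, 0 < δ → δ ≤ δ₁ →
      (∀ u, u ∈ S δ ↔ ((δ : ℂ) * hexCenter u ∈ Ω ∧
        (∀ i, ¬ (|((δ : ℂ) * hexCenter u).re - (p i).re| < ρc + 10 * δ ∧ mlo i δ ≤ u.1 1 ∧ u.1 1 < m i δ)) ∧
        closedBall ((δ : ℂ) * hexCenter u) (25 * δ) ⊆ Ω ∪ X δ)) ∧
      (∀ z ∈ X δ, ∃ i, |z.re - (p i).re| ≤ (ρc + 10 * δ) - 10 * δ ∧ (p i).im - 30 * δ ≤ z.im ∧ z.im ≤ (p i).im) ∧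
      (∀ i (u : HexVertex), ((δ : ℂ) * hexCenter u).im ≤ (p i).im → u.1 1 < m i δ) ∧
      (∀ i (u : HexVertex), (p i).im - ρc' / 2 ≤ ((δ : ℂ) * hexCenter u).im → mlo i δ ≤ u.1 1) ∧
      (∀ i (u : HexVertex), mlo i δ ≤ u.1 1 → (p i).im - ρc' + 8 * δ ≤ ((δ : ℂ) * hexCenter u).im) := by
    intro δ hδ hδle
    have hδc' : δ ≤ ρc' / 80 := hδle.trans (min_le_right _ _)
    refine ⟨fun u => Iff.rfl, fun z hz => ?_, fun i u hu => hm_lo i δ u hδ hu, fun i u hu => ?_, fun i u hu => ?_⟩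
    · obtain ⟨i, hi⟩ := mem_iUnion.1 hz
      exact ⟨i, by linarith [hi.1], hi.2.1, hi.2.2⟩
    · exact (twoPiece_mlo_spec hδ (by linarith) (p i).im).2 u hu
    · exact (twoPiece_mlo_spec hδ (by linarith) (p i).im).1 u hu
  have hinner : ∀ δ : ℝ, 0 < δ ∧ δ ≤ δ₁ → ∃ Λ : Finset HexVertex, hexDomainSimplyConnected Λ ∧
      (hexGraph.induce (↑Λ : Set HexVertex)).Preconnected ∧
      ∀ z : HexVertex, z ∈ Λ ↔ PathIn hexGraph (S δ) (v₀ δ) z := by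
    rintro δ ⟨hδ, hδle⟩
    have hδc : δ ≤ ρc / 40 := hδle.trans (min_le_left _ _)
    have hδc' : δ ≤ ρc' / 80 := hδle.trans (min_le_right _ _)
    obtain ⟨hS', hX', hμ, hmlo', hzone⟩ := hgood δ hδ hδle
    exact twoPiece_exists_inner_finset (ρₓ := ρc + 10 * δ) (σ := 30 * δ) (D := ρc' / 2) hδ (by linarith)
      hR0.le hR hE hEfr (by linarith) (by linarith) (by linarith) (by linarith) (by positivity)
      hS' hX' hB hμ hmlo' hzone (v₀ δ)
  -- deep reachability of compacts, in the form used twice below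
  have hreachK : ∀ K : Set ℂ, IsCompact K → K ⊆ Ω → ∀ᶠ δ : ℝ in 𝓝[>] 0, 0 < δ ∧ δ ≤ δ₁ ∧
      ∀ v : HexVertex, (δ : ℂ) * hexCenter v ∈ K → PathIn hexGraph (S δ) (v₀ δ) v := by
    intro K hK hKΩ
    obtain ⟨ε, hε, hreach⟩ := twoPiece_pathIn_of_isCompact hΩo hΩc hρc.le hρc'.le hB hK hKΩ hx₀Ω
    have hev : ∀ᶠ δ : ℝ in 𝓝[>] 0, δ ∈ Ioc 0 (min δ₁ (ε / 50)) :=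
      Ioc_mem_nhdsGT (lt_min hδ₁0 (by positivity))
    filter_upwards [hev, hm_hi 0 (ε / 8) (by positivity), hm_hi 1 (ε / 8) (by positivity)] with δ hδ h0 h1
    have hδle : δ ≤ δ₁ := hδ.2.trans (min_le_left _ _)
    refine ⟨hδ.1, hδle, fun v hv => ?_⟩
    have hthr : ∀ i (u : HexVertex), u.1 1 < m i δ → ((δ : ℂ) * hexCenter u).im < (p i).im + ε / 8 := by
      intro i u hu; fin_cases i
      · exact h0 u hu
      · exact h1 u hu
    obtain ⟨-, -, -, -, hzone⟩ := hgood δ hδ.1 hδle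
    exact hreach δ (fun i => m i δ) (fun i => mlo i δ) (X δ) hδ.1 (hδ.2.trans (min_le_right _ _)) hthr
      (fun i u hu => by linarith [hzone i u hu, hδ.1]) (v₀ δ) v (hv₀d δ hδ.1) hv
  refine ⟨fun δ => if hδ : 0 < δ ∧ δ ≤ δ₁ then (hinner δ hδ).choose else ∅, ?_, ?_, ?_, ?_⟩
  · -- simply connected, connected, inside `Ω`
    filter_upwards [Ioc_mem_nhdsGT hδ₁0] with δ hδ
    rw [dif_pos (show 0 < δ ∧ δ ≤ δ₁ from hδ)]
    obtain ⟨h1, h2, h3⟩ := (hinner δ hδ).choose_spec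
    exact ⟨h1, h2, fun v hv => ((h3 v).1 hv).right_mem.1⟩
  · -- exhaustion of compacts
    intro K hK hKΩ
    filter_upwards [hreachK K hK hKΩ] with δ ⟨hδ, hδle, hK'⟩ v hv
    rw [dif_pos (show 0 < δ ∧ δ ≤ δ₁ from ⟨hδ, hδle⟩), ((hinner δ ⟨hδ, hδle⟩).choose_spec).2.2]
    exact hK' v hv
  · -- exact rows near the gates
    set K₀ : Set ℂ := ⋃ i, closedBall (p i + ((ρF / 4 : ℝ) : ℂ) * Complex.I) (ρF / 16) with hK₀
    have hK₀c : IsCompact K₀ := isCompact_iUnion fun i => isCompact_closedBall _ _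
    have hK₀Ω : K₀ ⊆ Ω := iUnion_subset hball
    have hev : ∀ᶠ δ : ℝ in 𝓝[>] 0, δ ∈ Ioc 0 (ρF / 64) := Ioc_mem_nhdsGT (by positivity)
    filter_upwards [hreachK K₀ hK₀c hK₀Ω, hev, hm_hi 0 ρc' hρc', hm_hi 1 ρc' hρc']
      with δ ⟨hδ, hδle, hreach⟩ hδF h0 h1 i v hvp
    have hδc : δ ≤ ρc / 40 := hδle.trans (min_le_left _ _)
    obtain ⟨-, -, hμ, hmlo', hzone⟩ := hgood δ hδ hδle
    rw [dif_pos (show 0 < δ ∧ δ ≤ δ₁ from ⟨hδ, hδle⟩), ((hinner δ ⟨hδ, hδle⟩).choose_spec).2.2]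
    constructor
    · -- members have row `≥ m`
      intro hv
      have hvS : v ∈ S δ := hv.right_mem
      by_contra hlt
      push Not at hlt
      refine hvS.2.1 i ⟨?_, hmlo' i v ?_, hlt⟩
      · have := (Complex.abs_re_le_norm _).trans_eq' (by rw [Complex.sub_re]) |>.trans_lt
          (by rw [← dist_eq_norm]; exact hvp : ‖(δ : ℂ) * hexCenter v - p i‖ < ρF / 32)
        linarith
      · have := im_sub_im_le_dist (p i) ((δ : ℂ) * hexCenter v)
        rw [dist_comm] at this
        linarith
    · -- rows `≥ m` ascend to the target disc through deep vertices
      intro hvm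
      have hvim : (p i).im < ((δ : ℂ) * hexCenter v).im := by
        by_contra hle; push Not at hle
        exact (hμ i v hle).not_ge hvm
      have hthr : ∀ j (u : HexVertex), u.1 1 < m j δ → ((δ : ℂ) * hexCenter u).im < (p j).im + ρc' := by
        intro j u hu; fin_cases j
        · exact h0 u hu
        · exact h1 u hu
      set y : ℂ := (δ : ℂ) * hexCenter v + ((ρF / 4 : ℝ) : ℂ) * Complex.I with hy
      have hyv : dist ((δ : ℂ) * hexCenter v) y = ρF / 4 := by
        rw [dist_comm, hy, dist_eq_norm, add_sub_cancel_left, norm_mul, Complex.norm_real, Complex.norm_I,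
          mul_one, Real.norm_of_nonneg (by positivity)]
      obtain ⟨z, q, hz, hq⟩ := exists_walk_dist_smul_le hδ v y
      have hvz : PathIn hexGraph (S δ) v z := by
        refine pathIn_of_walk q fun u hu => ?_
        exact twoPiece_ascent_deep hδ hFc (by linarith [hδF.2]) hsep hfl hthr
          (fun j u hu => by linarith [hzone j u hu]) i hvp hvim hvm ((hq u hu).trans_eq hyv)
      have h3 : δ / Real.sqrt 3 ≤ δ := by
        refine div_le_self hδ.le ?_
        rw [show (1 : ℝ) = Real.sqrt 1 by simp]
        exact Real.sqrt_le_sqrt (by norm_num)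
      have hzK : (δ : ℂ) * hexCenter z ∈ K₀ := by
        refine mem_iUnion.2 ⟨i, mem_closedBall.2 ?_⟩
        calc dist ((δ : ℂ) * hexCenter z) (p i + ((ρF / 4 : ℝ) : ℂ) * Complex.I)
            ≤ dist ((δ : ℂ) * hexCenter z) y + dist y (p i + ((ρF / 4 : ℝ) : ℂ) * Complex.I) :=
              dist_triangle _ _ _
          _ ≤ δ + ρF / 32 := by
              refine add_le_add (hz.trans h3) ?_
              rw [hy, dist_add_right]; exact hvp.le
          _ ≤ ρF / 16 := by linarith [hδF.2]
      exact (hreach z hzK).trans hvz.symm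
  · -- closure under clearly-deep paths
    filter_upwards [Ioc_mem_nhdsGT hδ₁0, hm_hi 0 ρc' hρc', hm_hi 1 ρc' hρc'] with δ hδ h0 h1 z w hz hzw
    obtain ⟨-, -, -, -, hzone⟩ := hgood δ hδ.1 hδ.2
    have hthr : ∀ j (u : HexVertex), u.1 1 < m j δ → ((δ : ℂ) * hexCenter u).im < (p j).im + ρc' := by
      intro j u hu; fin_cases j
      · exact h0 u hu
      · exact h1 u hu
    rw [dif_pos (show 0 < δ ∧ δ ≤ δ₁ from hδ), ((hinner δ hδ).choose_spec).2.2] at hz ⊢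
    refine hz.trans (hzw.mono fun u hu => ?_)
    exact twoPiece_deep_of_clearlyDeep hthr (fun j u hu' => by linarith [hzone j u hu', hδ.1]) hu.1 hu.2.1
      hu.2.2

end Summit.CriticalPhenomena.SAWScalingLimit.Theorems.ObservableToSLE.TypeLadder

end
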